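import Summits.ResolutionOfSingularities.ResolutionOfSingularities.Theorems.FrobeniusLadderFRationalResolutionFixedPointBlowupRegularVeronese
import HarnessLib

/-!
# Crux `FrobeniusLadder.FRationalResolution` (stmt-ResolutionOfSingularities-15317), line `redirect`,
# stub `stub_diagonalizableQuotientResolution` — ONE POINT BLOW-UP RESOLVES ANY TORIC-CHARTED LOCAL RING WHOSE MONOMIAL MODEL HAS A
# REGULAR VERTEX BLOW-UP (local-ring form of `…FixedPointBlowupRegular`, p840843 — the brick for the SECOND step of the naive
# two-step recipe, whose singular points are again toric-charted)

`…FixedPointBlowupRegular.isRegular_affineBlowup_maximalIdeal_of_parameters` (p840843) lives in the frame of a graded algebra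
`S` and a fixed prime. Its engine is frame-free: `…FixedPointCompletionChart.exists_ringEquiv_monoidPowerSeries_adicCompletion_of_chartData`
(p840792: ANY Noetherian local ring `R` containing a field, with d = 0 Kato chart data by a finitely generated `P ⊆ ℕⁿ`, has
`κ(R)⟦P⟧ ≃+* R^`) + `…MonomialAlgebraCompletion.exists_ringEquiv_monoidPowerSeries_adicCompletion_of_chart` (`κ⟦P⟧ ≅ (κ[P]_𝔳)^`)
+ `…ToricModelTransfer.isRegular_affineBlowup_maximalIdeal_of_ringEquiv_model` + faithfully flat descent
`…BlowupRegularFlatChart.isRegular_affineBlowup_of_adicCompletion`. Stated for a bare local ring, it serves the hypothesis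
`hmodel` of the two-step consumers (`…EtaleChartTwoStepModelScheme`, `…FixedPointTwoStepModel`): the non-regular points `𝔫` of
the first blow-up `Bl_{𝔳^{a+1}}(Spec κ[P])` of a toric model are torus-fixed points of toric charts, so `κ[P][𝔳^{a+1}/xᵢ]_𝔫`
carries d = 0 chart data by the monoid `P'` of the corresponding cone, and `Bl_𝔫` is regular as soon as `Bl_{𝔳'} Spec κ(𝔫)[P']`
is — e.g. always when `P'` is a Veronese monoid (`veroneseCone_isRegular_affineBlowup`, p807148).

* ★★ `isRegular_affineBlowup_maximalIdeal_of_chartData_model` — generic charted model `(T, 𝔳, χ₀)` of finite type over `κ(R)`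
  with `Bl_𝔳(Spec T)` regular ⇒ `Bl_{𝔪_R}(Spec R)` regular (the frame for chart computations with quotient presentations);
* ★★★ `isRegular_affineBlowup_maximalIdeal_of_chartData` — `R` Noetherian local containing a field, `χ : ℕⁿ → R` multiplicative
  on `P = ⟨G⟩` (`G` finite, `0 ∉ G`) with `χ 0 = 1`, `χ(P ∖ 0) ⊆ 𝔪_R` generating `𝔪_R`, `dim R = rank P`, and
  `Bl_𝔳 Spec κ(R)[χᵈ : d ∈ G]` regular ⇒ **`Bl_{𝔪_R}(Spec R)` regular**;
* ★★★ `isRegular_affineBlowup_maximalIdeal_of_veroneseChart` — the same for the Veronese monoid `P = {m : r ∣ |m|}` (`r ≥ 1`,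
  `dim R = n`): NO certificate needed (type `1/r(1,…,1)`).

Honest label: helper theorems toward ONE leaf stub (no stub, crux or summit closed). No definitions, no named facts, no sorry.
[cite: Kato1994, Thm. (3.2)] [cite: Matsumura1987, Thm. 8.11; Thm. 8.14; §32 p. 256] [cite: StacksProject, Tag 07PT]
-/

noncomputable section

-- single-problem summit: the doubled namespace component is forced
set_option linter.dupNamespace false

open AlgebraicGeometry IsLocalRing
open Literature.RingTheory.MvPowerSeries Literature.RingTheory.MvPowerSeries.monoidPowerSeries
open Literature.AlgebraicGeometry.Resolution

namespace Summit.ResolutionOfSingularities.ResolutionOfSingularities.Theorems.FRationalResolution.LocalToricModelBlowup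

variable {n : ℕ}

/-- ★★ **ONE POINT BLOW-UP AT A TORIC-CHARTED LOCAL RING, FROM ANY CHARTED MODEL.** `R` a Noetherian local ring containing
a field `K`, with d = 0 chart data `χ : ℕⁿ → R` by a finitely generated `P ⊆ ℕⁿ` (`χ 0 = 1`, multiplicative on `P`,
`χ(P ∖ 0) ⊆ 𝔪_R` generating `𝔪_R`, `dim R = rank P`); a MODEL: `T` of finite type over `κ(R)`, `𝔳` maximal and
`κ(R)`-rational, charted by the same `P` (`χ₀`), `dim T_𝔳 = rank P`, with `Bl_𝔳(Spec T)` regular. Then **`Bl_{𝔪_R}(Spec R)` is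
regular**: `(T_𝔳)^ ≅ κ(R)⟦P⟧ ≅ R^`, transport, faithfully flat descent. (Generic in the model on purpose: quotient presentations
of `κ(R)[P]` are the convenient frame for chart computations; the sub-algebra presentation is the next theorem.)
[cite: Kato1994, Thm. (3.2)] [cite: Matsumura1987, Thm. 8.11; Thm. 8.14; §32 p. 256] [cite: StacksProject, Tag 07PT] -/
theorem isRegular_affineBlowup_maximalIdeal_of_chartData_model {R : Type} [CommRing R] [IsLocalRing R] [IsNoetherianRing R]
    {K : Type} [Field K] (i : K →+* R)
    (P : AddSubmonoid (Fin n →₀ ℕ)) (hPfg : P.FG)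
    (χ : (Fin n →₀ ℕ) → R) (hχ0 : χ 0 = 1) (hχadd : ∀ a ∈ P, ∀ b ∈ P, χ (a + b) = χ a * χ b)
    (hχm : ∀ p ∈ P, p ≠ 0 → χ p ∈ maximalIdeal R)
    (hgen : maximalIdeal R ≤ Ideal.span (χ '' {p | p ∈ P ∧ p ≠ 0}))
    (hdim : ringKrullDim R = rank P)
    (T : Type) [CommRing T] [Algebra (ResidueField R) T] [Algebra.FiniteType (ResidueField R) T]
    (𝔳 : Ideal T) [𝔳.IsMaximal]
    (hres : ∀ z : Localization.AtPrime 𝔳, ∃ c : ResidueField R,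
      z - algebraMap _ (Localization.AtPrime 𝔳) c ∈ maximalIdeal (Localization.AtPrime 𝔳))
    (χ₀ : (Fin n →₀ ℕ) → T) (hχ₀0 : χ₀ 0 = 1) (hχ₀add : ∀ a ∈ P, ∀ b ∈ P, χ₀ (a + b) = χ₀ a * χ₀ b)
    (hχ₀m : ∀ p ∈ P, p ≠ 0 → χ₀ p ∈ 𝔳) (hgen₀ : 𝔳 ≤ Ideal.span (χ₀ '' {p | p ∈ P ∧ p ≠ 0}))
    (hdim₀ : ringKrullDim (Localization.AtPrime 𝔳) = rank P)
    (hreg : Scheme.IsRegular (affineBlowup 𝔳)) :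
    Scheme.IsRegular (affineBlowup (maximalIdeal R)) := by
  haveI : IsNoetherianRing T := Algebra.FiniteType.isNoetherianRing (ResidueField R) T
  -- `κ(R)⟦P⟧ ≅ R^` (Kato chart data) and `κ(R)⟦P⟧ ≅ (T_𝔳)^` (the model)
  obtain ⟨e₁, -⟩ := FixedPointCompletionChart.exists_ringEquiv_monoidPowerSeries_adicCompletion_of_chartData i P hPfg χ
    hχ0 hχadd hχm hgen hdim
  obtain ⟨e₀, -⟩ := MonomialAlgebraCompletion.exists_ringEquiv_monoidPowerSeries_adicCompletion_of_chart (ResidueField R)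
    𝔳 hres P hPfg χ₀ hχ₀0 hχ₀add hχ₀m hgen₀ hdim₀
  -- transport the regular blow-up to `R^`, then descend to `R`
  have h := ToricModelTransfer.isRegular_affineBlowup_maximalIdeal_of_ringEquiv_model (ResidueField R) _ hreg
    (e₀.symm.trans e₁)
  rw [AdicCompletion.maximalIdeal_eq_map] at h
  exact BlowupRegularFlatChart.isRegular_affineBlowup_of_adicCompletion (maximalIdeal R) h

/-- ★★★ **ONE POINT BLOW-UP AT A TORIC-CHARTED LOCAL RING, FROM THE MONOMIAL MODEL.** `R` a Noetherian local ring containing a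
field `K`; `G ⊆ ℕⁿ ∖ {0}` finite, `P = ⟨G⟩`; `χ : ℕⁿ → R` with `χ 0 = 1`, multiplicative on `P`, `χ(P ∖ 0) ⊆ 𝔪_R` generating
`𝔪_R`; `dim R = rank P`. If the blow-up of `Spec κ(R)[χᵈ : d ∈ G]` at its vertex is a regular scheme, then
**`Bl_{𝔪_R}(Spec R)` is a regular scheme** (`(κ(R)[P]_𝔳)^ ≅ κ(R)⟦P⟧ ≅ R^`, transport, faithfully flat descent).
[cite: Kato1994, Thm. (3.2)] [cite: Matsumura1987, Thm. 8.11; Thm. 8.14; §32 p. 256] [cite: StacksProject, Tag 07PT] -/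
theorem isRegular_affineBlowup_maximalIdeal_of_chartData {R : Type} [CommRing R] [IsLocalRing R] [IsNoetherianRing R]
    {K : Type} [Field K] (i : K →+* R)
    (G : Set (Fin n →₀ ℕ)) (hGfin : G.Finite) (hG0 : (0 : Fin n →₀ ℕ) ∉ G)
    (P : AddSubmonoid (Fin n →₀ ℕ)) (hGP : AddSubmonoid.closure G = P)
    (χ : (Fin n →₀ ℕ) → R) (hχ0 : χ 0 = 1) (hχadd : ∀ a ∈ P, ∀ b ∈ P, χ (a + b) = χ a * χ b)
    (hχm : ∀ p ∈ P, p ≠ 0 → χ p ∈ maximalIdeal R)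
    (hgen : maximalIdeal R ≤ Ideal.span (χ '' {p | p ∈ P ∧ p ≠ 0}))
    (hdim : ringKrullDim R = rank P)
    (hreg : Scheme.IsRegular (affineBlowup (Ideal.span {v : ↥(Algebra.adjoin (ResidueField R)
        ((fun d : Fin n →₀ ℕ => MvPolynomial.monomial d (1 : ResidueField R)) '' G)) |
        ∃ d ∈ G, (v : MvPolynomial (Fin n) (ResidueField R)) = MvPolynomial.monomial d 1}))) :
    Scheme.IsRegular (affineBlowup (maximalIdeal R)) := by
  haveI := MonomialAlgebraVertex.vertexIdeal_isMaximal (ResidueField R) G hG0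
  haveI : Algebra.FiniteType (ResidueField R) (↥(Algebra.adjoin (ResidueField R)
      ((fun d : Fin n →₀ ℕ => MvPolynomial.monomial d (1 : ResidueField R)) '' G))) :=
    MonomialAlgebraVertex.finiteType (ResidueField R) G hGfin
  have hPfg : P.FG := ⟨hGfin.toFinset, by rw [Set.Finite.coe_toFinset, hGP]⟩
  obtain ⟨χ₀, -, hχ₀0, hχ₀add, hχ₀m, hgen₀⟩ := MonomialAlgebraCompletion.exists_chart (ResidueField R) G hG0 P hGP
  exact isRegular_affineBlowup_maximalIdeal_of_chartData_model i P hPfg χ hχ0 hχadd hχm hgen hdim _ _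
    (MonomialAlgebraVertex.exists_sub_algebraMap_mem_maximalIdeal (ResidueField R) G) χ₀ hχ₀0 hχ₀add hχ₀m hgen₀
    (MonomialAlgebraDimension.ringKrullDim_localization_vertex_eq_rank (ResidueField R) G hGfin hG0 P hGP) hreg

/-- ★★★ **ONE POINT BLOW-UP AT A LOCAL RING OF VERONESE TYPE `1/r(1,…,1)`.** `R` a Noetherian local ring containing a field,
`r ≥ 1`, `χ : ℕⁿ → R` with `χ 0 = 1`, multiplicative on the Veronese monoid `P = {m : r ∣ |m|} = ⟨d : |d| = r⟩`,
`χ(P ∖ 0) ⊆ 𝔪_R` generating `𝔪_R`, `dim R = n`. Then **`Bl_{𝔪_R}(Spec R)` is a regular scheme** — no certificate needed, the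
Veronese cone has a regular vertex blow-up (`veroneseCone_isRegular_affineBlowup`, p807148).
[cite: Kato1994, Thm. (3.2)] [cite: Kollar2007, §2.2] [cite: Matsumura1987, Thm. 8.11; §32 p. 256] -/
theorem isRegular_affineBlowup_maximalIdeal_of_veroneseChart {R : Type} [CommRing R] [IsLocalRing R] [IsNoetherianRing R]
    {K : Type} [Field K] (i : K →+* R) (r : ℕ) (hr : 1 ≤ r)
    (χ : (Fin n →₀ ℕ) → R) (hχ0 : χ 0 = 1)
    (hχadd : ∀ a b : Fin n →₀ ℕ, r ∣ Finsupp.degree a → r ∣ Finsupp.degree b → χ (a + b) = χ a * χ b)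
    (hχm : ∀ p : Fin n →₀ ℕ, r ∣ Finsupp.degree p → p ≠ 0 → χ p ∈ maximalIdeal R)
    (hgen : maximalIdeal R ≤ Ideal.span (χ '' {p | r ∣ Finsupp.degree p ∧ p ≠ 0}))
    (hdim : ringKrullDim R = n) :
    Scheme.IsRegular (affineBlowup (maximalIdeal R)) := by
  classical
  set G : Set (Fin n →₀ ℕ) := {d : Fin n →₀ ℕ | Finsupp.degree d = r} with hG
  set P : AddSubmonoid (Fin n →₀ ℕ) := AddSubmonoid.closure G with hPdef
  have hmemP : ∀ m : Fin n →₀ ℕ, m ∈ P ↔ r ∣ Finsupp.degree m := fun m =>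
    MonomialAlgebraCompletion.mem_closure_degree_eq_iff n r m
  have hGfin : G.Finite := (Finsupp.finite_of_degree_le r).subset fun d hd => le_of_eq hd
  have hG0 : (0 : Fin n →₀ ℕ) ∉ G := by
    simp only [hG, Set.mem_setOf_eq, map_zero]
    omega
  -- `P` is the weight kernel of the constant degrees `(1,…,1)` in `ℤ/r`, so `rank P = n`
  haveI : NeZero r := ⟨by omega⟩
  have hord : addOrderOf (1 : ZMod r) = r := ZMod.addOrderOf_one r
  have hPeq : P = AddMonoidHom.mker (Finsupp.weight (fun _ : Fin n => (1 : ZMod r)) : (Fin n →₀ ℕ) →+ ZMod r) := by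
    ext m
    rw [hmemP, AddMonoidHom.mem_mker, FixedPointBlowupRegular.weight_const_eq_zero_iff, hord]
  have hfin1 : ∀ _ : Fin n, IsOfFinAddOrder (1 : ZMod r) := fun _ =>
    addOrderOf_pos_iff.mp (by rw [hord]; omega)
  have hrank : rank P = n := by
    rw [hPeq]
    exact FixedPointCompletionChart.rank_mker_weight (fun _ : Fin n => (1 : ZMod r)) hfin1
  refine isRegular_affineBlowup_maximalIdeal_of_chartData i G hGfin hG0 P rfl χ hχ0
    (fun a ha b hb => hχadd a b ((hmemP a).mp ha) ((hmemP b).mp hb))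
    (fun p hp hp0 => hχm p ((hmemP p).mp hp) hp0) (hgen.trans (Ideal.span_mono ?_)) (by rw [hdim, hrank])
    (veroneseCone_isRegular_affineBlowup (ResidueField R) n r hr)
  rintro _ ⟨p, ⟨hp, hp0⟩, rfl⟩
  exact ⟨p, ⟨(hmemP p).mpr hp, hp0⟩, rfl⟩

end Summit.ResolutionOfSingularities.ResolutionOfSingularities.Theorems.FRationalResolution.LocalToricModelBlowup

end
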